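import Summits.NavierStokesRegularity.NavierStokesRegularity.Theorems.StrainDoorsCompositions
import Summits.NavierStokesRegularity.NavierStokesRegularity.Theorems.StrainDoorsThresholdLinear
import HarnessLib

/-!
# StrainDoorsCompositionsB — door family S37 «StrainDoors»: door Π from door H and the Poisson equation; plates
# «PoissonTrace», F_S «StrainFrame» closed; E2_S ⇐ D_S + E2_S-lin; doors H / Π from the open plates

P0-37 part 3 of 3: §7–§8 (`pressureFocusingDoor_of`, `poissonTrace_holds`, `strainFrame_holds`, `strainThreshold_of`, `strainFeedingDoor_of_plates`, `pressureFocusingDoor_of_plates`) of nsreg-p1 g31's `r35/Sketch37.lean` sha16 265cb074f1d98fd0 (ROUND-35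
c653b89364d543f7; PLATE-AID-37 a5968f2ee6b16dfe cut), every declaration byte-identical, order preserved; landed by ns-s29-p2 g4
on LEAD ns-s30-p1 g3's key 2026-08-28T18:39:13Z (a), `--supports stmt-NavierStokesRegularity-0056 --as helper`.  Texts in
`Theorems/StrainDoorsDefs.lean`.

HONEST FRAME: regularity CRITERIA read at ONE POINT PER TIME (the argmax of the strain quotient `⟪∇u e, e⟫`); UNCONDITIONAL
where closed (no named-fact hypothesis); item 0056 `NoTypeII` and NS regularity are NOT proved; nothing here is a route or a
summit statement.
-/

noncomputable section

open MeasureTheory Set Function Filter Metric Real InnerProductSpace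
open _root_.Topology
open scoped ENNReal NNReal RealInnerProductSpace ContDiff Laplacian
open Literature.Analysis Literature.Analysis.FluidPDE
open Literature.Analysis.FluidPDE.VorticityDirectionDynamics

set_option linter.dupNamespace false

namespace Summit.NavierStokesRegularity.NavierStokesRegularity.Theorems.StrainDoors

open Summit.NavierStokesRegularity.NavierStokesRegularity.Theorems.ArgmaxDoors

-- nested operator types (second derivatives)
set_option maxSynthPendingDepth 3
/-! ## §7 Door S37-Π from door S37-H and the Poisson equation -/

/-- **Door S37-Π from door S37-H**: `PoissonTrace → StrainFeedingDoor → PressureFocusingDoor`. On `(t₁,T)`,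
`t₁ = (t₀+T)/2 > 0`, the Poisson equation `Δp = |ω|² − |∇u|²_F` turns
`⅓|S|² + (1/12)|ω|² − ¼⟪ω,e⟫² − Π(e,e)` into `¼(|ω|² − ⟪ω,e⟫²) − ∇²p(e,e)` identically. [folklore] -/
theorem pressureFocusingDoor_of (hP : PoissonTrace) (hH : StrainFeedingDoor) : PressureFocusingDoor := by
  intro ν T t₀ y₀ c hν ht₀ ht₀T hy₀ hy₀1 hc u p hsol hreg hhyp
  have hT : 0 < T := lt_of_le_of_lt ht₀ ht₀T
  set t₁ : ℝ := (t₀ + T) / 2 with ht₁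
  have ht₁0 : 0 < t₁ := by rw [ht₁]; linarith
  have ht₀t₁ : t₀ ≤ t₁ := by rw [ht₁]; linarith
  have ht₁T : t₁ < T := by rw [ht₁]; linarith
  refine hH ν T t₁ y₀ c hν ht₁0.le ht₁T hy₀ hy₀1 hc u p hsol hreg ?_
  intro t ht x e hax hbig
  have hPt := hP ν T hν hT u p hsol t ⟨ht₁0.trans_le ht.1, ht.2⟩ x
  have h := hhyp t ⟨ht₀t₁.trans ht.1, ht.2⟩ x e hax hbig
  have hid : strainFeed u p t x e = (1 / 3) * strainNormSq u t x + (1 / 12) * ‖curl (u t) x‖ ^ 2 -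
      (1 / 4) * ⟪curl (u t) x, e⟫ ^ 2 - devPressureHess p t x e := by
    rw [devPressureHess_eq p t x hax.1]
    unfold strainFeed strainNormSq pressureHess
    rw [hPt]
    ring
  rw [hid]
  exact h

/-! ## §8 Plates closed here: «PoissonTrace», F_S «StrainFrame», E2_S ⇐ D_S + E2_S-lin; doors H / Π from the open plates -/

/-- **Plate «PoissonTrace» PROVED** (3 lines over the S-lane's landed trace form p656816
`ArgmaxDoors.laplacian_pressure_eq_neg_traceCLM : Δp = −tr(∇u ∘ ∇u)` (ns-sfl-p1 g5, `Theorems/StrainDoorsPoissonTrace.lean`)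
and `frobeniusNormSq_fderiv_eq_sq_norm_curl_add_trace : |∇u|²_F = |curl u|² + tr(∇u ∘ ∇u)`). [folklore] -/
theorem poissonTrace_holds : PoissonTrace := by
  intro ν T hν hT u p hsol t ht x
  have h1 := ArgmaxDoors.laplacian_pressure_eq_neg_traceCLM hsol ht x
  have h3 := frobeniusNormSq_fderiv_eq_sq_norm_curl_add_trace (u t) x
  linarith

/-- **Plate F_S «StrainFrame» PROVED**: the momentum equation differentiated along `e` — mixed partials
commute for the jointly smooth velocity (`IsSmoothSpaceTimeOn.timeDerivWithin_fderiv_slice_apply` on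
`[0,T)`, `[0,T) ⊆ closure (0,T)`), and `∇p = νΔu − ∂ₜu − (u·∇)u` is differentiated term by term
(`differentiable_laplacian`, `Differentiable.clm_apply`). [folklore] -/
theorem strainFrame_holds : StrainFrame := by
  intro ν T hν hT u p hsol t ht x e
  have hU : UniqueDiffOn ℝ (Ico 0 T) := uniqueDiffOn_Ico 0 T
  have hcl : Ico 0 T ⊆ closure (interior (Ico 0 T)) := by
    rw [interior_Ico, closure_Ioo hT.ne]
    exact Ico_subset_Icc_self
  rw [hsol.smooth_velocity.timeDerivWithin_fderiv_slice_apply hU hcl ht x e]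
  set w : (EuclideanSpace ℝ (Fin 3)) → (EuclideanSpace ℝ (Fin 3)) := timeDerivWithin (Ico 0 T) u t
    with hw_def
  have hw : ContDiff ℝ ∞ w := (hsol.smooth_velocity.timeDerivWithin hU).contDiff_slice ht
  have hu : ContDiff ℝ ∞ (u t) := hsol.smooth_velocity.contDiff_slice ht
  have hu3 : ContDiff ℝ 3 (u t) := contDiff_infty.1 hu 3
  have hwd : Differentiable ℝ w := (contDiff_infty.1 hw 1).differentiable one_ne_zero
  have hud : Differentiable ℝ (u t) := (contDiff_infty.1 hu 1).differentiable one_ne_zero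
  have hDud : Differentiable ℝ (fderiv ℝ (u t)) :=
    ((contDiff_infty.1 hu 2).fderiv_right (m := 1) le_rfl).differentiable one_ne_zero
  have hΔd : Differentiable ℝ (Δ (u t)) := differentiable_laplacian hu3
  have hcd : Differentiable ℝ (convect (u t) (u t)) := by
    have : convect (u t) (u t) = fun y => fderiv ℝ (u t) y (u t y) := rfl
    rw [this]
    exact hDud.clm_apply hud
  -- the momentum equation solved for the pressure gradient
  have hgrad : gradient (p t) = fun y => ν • (Δ (u t)) y - w y - convect (u t) (u t) y := by
    funext y
    have hm := hsol.momentum t ht y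
    have h0 : (0 : ℝ → (EuclideanSpace ℝ (Fin 3)) → (EuclideanSpace ℝ (Fin 3))) t y = 0 := rfl
    rw [h0, add_zero] at hm
    rw [← sub_eq_zero] at hm ⊢
    rw [← hm]
    abel
  rw [hgrad]
  have d1 : DifferentiableAt ℝ (fun y => ν • (Δ (u t)) y) x := (hΔd x).const_smul ν
  have d2 : DifferentiableAt ℝ (fun y => ν • (Δ (u t)) y - w y) x := d1.sub (hwd x)
  rw [fderiv_fun_sub d2 (hcd x), fderiv_fun_sub d1 (hwd x), fderiv_fun_const_smul (hΔd x) ν]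
  simp only [sub_apply, FunLike.coe_smul, Pi.smul_apply]
  abel

/-- **E2_S (Riccati form) from D_S + E2_S-lin**: with `φ := −B + h/B` one has `φB = −B² + h ≤ B'`, and at a
charged argmax with `q = ⟪∇u ē,ē⟫ > B > 0`, `h ≥ 0`: `−q² + h ≤ φq` (`φq − (−q² + h) = (q − B)(q + h/B) ≥ 0`);
the decay hypothesis of E2_S-lin on `[t₁,t₂] ⊂ [0,t₂]` is plate D_S with `T'' = t₂`. [folklore] -/
theorem strainThreshold_of (hD : GradientUniformDecay) (hL : StrainThresholdLinear) : StrainThreshold := by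
  intro ν T t₁ t₂ hν ht₁ ht₁₂ ht₂T u p hsol hreg B B' h hBc hBpos hBd hsuper hh0 hrate hinit
  have hT : 0 < T := lt_of_le_of_lt ht₁ (ht₁₂.trans ht₂T)
  have hdec : ∀ η : ℝ, 0 < η → ∃ R : ℝ, ∀ t ∈ Icc t₁ t₂, ∀ x : EuclideanSpace ℝ (Fin 3),
      R ≤ ‖x‖ → ‖fderiv ℝ (u t) x‖ ≤ η := by
    intro η hη
    obtain ⟨R, hR⟩ := hD ν T hν hT u p hsol hreg t₂ ht₂T η hη
    exact ⟨R, fun t ht x hx => hR t ⟨ht₁.trans ht.1, ht.2⟩ x hx⟩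
  refine hL ν T t₁ t₂ hν ht₁ ht₁₂ ht₂T u p hsol hreg hdec B B' (fun t => -B t + h t / B t) hBc hBpos hBd
    ?_ ?_ hinit
  · intro t ht
    have hB := hBpos t ht
    have h1 : (-B t + h t / B t) * B t = -(B t) ^ 2 + h t := by
      have hB0 : B t ≠ 0 := hB.ne'
      rw [add_mul, div_mul_cancel₀ _ hB0]
      ring
    rw [h1]
    exact hsuper t ht
  · intro t ht x e hax hq
    have hB := hBpos t (Ioc_subset_Icc_self ht)
    have hh := hh0 t (Ioc_subset_Icc_self ht)
    have hq0 : 0 ≤ strainQuad u t x e := (hB.trans hq).le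
    refine (hrate t ht x e hax hq).trans ?_
    rw [← sub_nonneg]
    have h1 : (-B t + h t / B t) * strainQuad u t x e - (-(strainQuad u t x e) ^ 2 + h t) =
        (strainQuad u t x e - B t) * (strainQuad u t x e + h t / B t) := by
      have hB0 : B t ≠ 0 := hB.ne'
      have h2 : B t * (h t / B t) = h t := mul_div_cancel₀ _ hB0
      linear_combination h2
    rw [h1]
    exact mul_nonneg (sub_pos.2 hq).le (add_nonneg hq0 (div_nonneg hh hB.le))

/-- **Door S37-H from the OPEN plates E1_S «StrainGrowth», D_S «GradientUniformDecay», E2_S-lin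
«StrainThresholdLinear»** (F_S, PoissonTrace, door Λ are closed in this file / the tree; E2_S-lin is the NS
instance of the landed p655218). [folklore] -/
theorem strainFeedingDoor_of_plates (hG : StrainGrowth) (hD : GradientUniformDecay)
    (hL : StrainThresholdLinear) : StrainFeedingDoor :=
  strainFeedingDoor_of hG strainFrame_holds (strainThreshold_of hD hL) subcriticalStrainDoor_holds

/-- **Door S37-Π from the same open plates** (PoissonTrace closed above). [folklore] -/
theorem pressureFocusingDoor_of_plates (hG : StrainGrowth) (hD : GradientUniformDecay)
    (hL : StrainThresholdLinear) : PressureFocusingDoor :=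
  pressureFocusingDoor_of poissonTrace_holds (strainFeedingDoor_of_plates hG hD hL)

/-! ### By-name discharge of E2_S-lin (appended to the sketch cut) -/

/-- plate E2_S-lin «StrainThresholdLinear» DISCHARGED BY NAME: LEAD ns-s30-p1 g3's `ArgmaxDoors.strainThresholdLinear`
(`Theorems/StrainDoorsThresholdLinear.lean`, p657868) is the text with `IsStrainArgmax` / `strainQuad` / `strainRate`
δ-unfolded.  (E2_S itself then follows from D_S by `strainThreshold_of`; D_S «GradientUniformDecay» is open.) [folklore] -/
theorem strainThresholdLinear_holds : StrainThresholdLinear := strainThresholdLinear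

end Summit.NavierStokesRegularity.NavierStokesRegularity.Theorems.StrainDoors

end
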